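import Literature.AlgebraicGeometry.GroupSchemes.AffineGroupSchemeHopfAlgebra
import Mathlib.CategoryTheory.Monoidal.Cartesian.Over
import Mathlib.RingTheory.Ideal.Quotient.Operations
import HarnessLib

/-!
# Points through a base-change square of group schemes; an affine `R`-scheme as the test object `Spec Γ(W)`

Layer `Literature/AlgebraicGeometry/GroupSchemes`, namespace `Literature.AlgebraicGeometry.GroupSchemes`.  THEOREMS ONLY (no definition, no
named fact, no instance, no notation, no `sorry`).  Cell `hodgecm-mathlib` (D-0151 ∕ D-0183 FLOOR 0), P6 «MOD programme», Row 4B, plumbing for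
organ (E4) of the σ1 road of `stub_L4B1es_serreTateLift` (consumed by ★-to-be `BarsottiTateGroupCanonicalLift`); generic, count-neutral capital
on `--supports stmt-HodgeConjecture-24832`.  HC_CM is proved only modulo the printed citations until rung 0 closes; nothing here is about HC.

CONTENT.  A base-change square of group schemes is a morphism `c : M′ → M` of underlying schemes over `g : S′ → S` (`M′` an `S′`-group,
`M` an `S`-group) which is cartesian and compatible with the unit sections and the group laws — the three clauses of ★
`BTGroup.IsBaseChangeVia` ([Messing1972] Ch. I (1.1)–(1.6): the layers of a Barsotti–Tate group commute with base change), i.e.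
`M′ ≅ M ×_S S′` AS GROUP SCHEMES.  For a test scheme `T` over `S′` (hence over `S` by `b = T → S′ → S`):
* §1 `mul_left_comp_eq_of_sq`, `eq_one_of_left_eq_one_comp_of_sq`, `pow_left_comp_eq_of_sq` — PUSHING `T`-points of `M′` FORWARD along `c`
  is multiplicative ∕ unital ∕ compatible with powers (on underlying maps; the pushed points are taken as data with prescribed underlying
  maps, so that any presentation of the test object over `S` fits); `eq_of_left_comp_eq_of_isPullback`, `eq_mul_of_left_comp_eq_mul_of_sq`
  — LIFTING `S`-points through the cartesian `c` is injective and multiplicative.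
* §2 `exists_iso_specOver_alg` — an AFFINE `R`-scheme `W` is isomorphic over `R` to the test object `specOver R Γ(W)` (Mathlib
  `Scheme.isoSpec` and its naturality; the algebra `AffineGroupScheme.Alg W = Γ(W, 𝒪_W)` of ★ `AffineGroupSchemeHopfAlgebra`);
  `specMap_mk_comp_specMap_algebraMap` — `Spec (A⧸I) → Spec A → Spec R` factors as `Spec (A⧸I) → Spec (R⧸J) → Spec R` when `J A ⊆ I`.

## References
* [Messing1972] W. Messing, *The Crystals Associated to Barsotti–Tate Groups*, LNM 264 (1972), Ch. I (1.1)–(1.6).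
* [GortzWedhorn2023] U. Görtz, T. Wedhorn, *Algebraic Geometry II*, Springer (2023), §(27.2) (p. 606).
* [MumfordFogartyKirwan1994] D. Mumford, J. Fogarty, F. Kirwan, *Geometric Invariant Theory*, 3rd ed. (1994), Ch. 7 §2 Def. 7.2 (p. 129).
-/

noncomputable section

-- Mathlib's `Over`/pull-back API is stated across semireducible wrappers (as in the ★ `GroupSchemes/*` files).
set_option backward.isDefEq.respectTransparency false

universe u

open CategoryTheory CategoryTheory.Limits AlgebraicGeometry MonoidalCategory CartesianMonoidalCategory
open scoped MonObj

namespace Literature.AlgebraicGeometry.GroupSchemes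

open Literature.AlgebraicGeometry.Motives (specOver SchemeOver)

/-! ## §1 Points through a base-change square of group schemes: pushing forward is multiplicative, lifting is injective -/

section Square

variable {S S' : Scheme.{u}} {g : S' ⟶ S} {M : Over S} {M' : Over S'} [GrpObj M] [GrpObj M'] {c : M'.left ⟶ M.left}

/-- **Pushing `S′`-points of `M′` forward along a base-change square `c : M′ → M` (over `g : S′ → S`) is MULTIPLICATIVE** on
underlying maps: if `c` is compatible with the group laws (`μ′ ≫ c = (c ×_g c) ≫ μ`, the `μ`-clause of ★ `BTGroup.IsBaseChangeVia`),
then for `T`-points `y, y′` of `M′` and the `S`-points `Y, Y′` of `M` with underlying maps `y ≫ c`, `y′ ≫ c`, the product `Y · Y′` has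
underlying map `(y · y′) ≫ c`. [cite: Messing1972, Ch. I (1.1)–(1.6)] -/
theorem mul_left_comp_eq_of_sq (w : c ≫ M.hom = M'.hom ≫ g)
    (hμ : μ[M'].left ≫ c = pullback.map M'.hom M'.hom M.hom M.hom c c g w.symm w.symm ≫ μ[M].left)
    {T : Over S'} (y y' : T ⟶ M') {b : T.left ⟶ S} (Y Y' : Over.mk b ⟶ M) (hY : Y.left = y.left ≫ c)
    (hY' : Y'.left = y'.left ≫ c) : (y * y').left ≫ c = (Y * Y').left := by
  rw [Hom.mul_def, Hom.mul_def, Over.comp_left, Over.comp_left, Category.assoc, hμ, ← Category.assoc]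
  congr 1
  rw [Over.lift_left, Over.lift_left]
  apply pullback.hom_ext
  · rw [Category.assoc, pullback.lift_fst, pullback.lift_fst_assoc, pullback.lift_fst, hY]
  · rw [Category.assoc, pullback.lift_snd, pullback.lift_snd_assoc, pullback.lift_snd, hY']

/-- **The unit pushes forward to the unit**: with the `η`-clause `η′ ≫ c = g ≫ η`, the `S`-point of `M` with underlying map `1_T ≫ c`
is the unit. [cite: Messing1972, Ch. I (1.1)–(1.6)] -/
theorem eq_one_of_left_eq_one_comp_of_sq (hη : η[M'].left ≫ c = g ≫ η[M].left) {T : Over S'} {b : T.left ⟶ S}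
    (hb : b = T.hom ≫ g) (E : Over.mk b ⟶ M) (hE : E.left = (1 : T ⟶ M').left ≫ c) : E = 1 := by
  apply Over.OverMorphism.ext
  rw [hE, Hom.one_def, Hom.one_def, Over.comp_left, Over.comp_left, Category.assoc, hη, ← Category.assoc,
    Over.toUnit_left, Over.toUnit_left]
  exact congrArg (· ≫ η[M].left) hb.symm

/-- … hence POWERS push forward to powers: `Y^k` has underlying map `(y^k) ≫ c`. [cite: Messing1972, Ch. I (1.1)–(1.6)] -/
theorem pow_left_comp_eq_of_sq (w : c ≫ M.hom = M'.hom ≫ g) (hη : η[M'].left ≫ c = g ≫ η[M].left)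
    (hμ : μ[M'].left ≫ c = pullback.map M'.hom M'.hom M.hom M.hom c c g w.symm w.symm ≫ μ[M].left)
    {T : Over S'} (y : T ⟶ M') {b : T.left ⟶ S} (hb : b = T.hom ≫ g) (Y : Over.mk b ⟶ M) (hY : Y.left = y.left ≫ c)
    (k : ℕ) : (y ^ k).left ≫ c = (Y ^ k).left := by
  induction k with
  | zero =>
    rw [pow_zero, pow_zero]
    exact congrArg Over.Hom.left (eq_one_of_left_eq_one_comp_of_sq hη hb
      (Over.homMk ((1 : T ⟶ M').left ≫ c) (by rw [Category.assoc, w, ← Category.assoc, Over.w]; exact hb.symm)) rfl)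
  | succ k ih =>
    rw [pow_succ, pow_succ]
    exact mul_left_comp_eq_of_sq w hμ (y ^ k) y (Y ^ k) Y ih.symm hY

omit [GrpObj M] [GrpObj M'] in
/-- **Lifting through the cartesian square is INJECTIVE**: two `T`-points of `M′` with the same push-forward `y ≫ c` are equal
(`M′ = M ×_S S′`). [cite: Messing1972, Ch. I (1.1)–(1.6)] -/
theorem eq_of_left_comp_eq_of_isPullback (hc : IsPullback c M'.hom M.hom g) {T : Over S'} (y y' : T ⟶ M')
    (h : y.left ≫ c = y'.left ≫ c) : y = y' := by
  apply Over.OverMorphism.ext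
  exact hc.hom_ext h (by rw [Over.w, Over.w])

/-- **Lifting through the cartesian square is MULTIPLICATIVE**: if `y`, `y′`, `z` lift the `S`-points `Y`, `Y′`, `Y · Y′` (same
underlying maps after `c`), then `z = y · y′`. [cite: Messing1972, Ch. I (1.1)–(1.6)] -/
theorem eq_mul_of_left_comp_eq_mul_of_sq (w : c ≫ M.hom = M'.hom ≫ g) (hc : IsPullback c M'.hom M.hom g)
    (hμ : μ[M'].left ≫ c = pullback.map M'.hom M'.hom M.hom M.hom c c g w.symm w.symm ≫ μ[M].left)
    {T : Over S'} (y y' z : T ⟶ M') {b : T.left ⟶ S} (Y Y' : Over.mk b ⟶ M) (hY : Y.left = y.left ≫ c)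
    (hY' : Y'.left = y'.left ≫ c) (hz : z.left ≫ c = (Y * Y').left) : z = y * y' :=
  eq_of_left_comp_eq_of_isPullback hc z (y * y') (by rw [hz, mul_left_comp_eq_of_sq w hμ y y' Y Y' hY hY'])

end Square

/-! ## §2 An affine `R`-scheme is the test object `Spec Γ(W)`; the reduction of `Spec A` modulo `J·A` is a base change of `Spec (R⧸J) ↪ Spec R` -/

section Affine

variable {R : Type u} [CommRing R] (W : SchemeOver R) [IsAffine W.left]

/-- **An affine `R`-scheme `W` IS the test object `specOver R Γ(W)`** (`W ≅ Spec Γ(W, 𝒪_W)` over `R`, Mathlib `Scheme.isoSpec` and its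
naturality), as an isomorphism in `Over (Spec R)` whose underlying map is `isoSpec.inv`. [cite: GortzWedhorn2023, §(27.2) (p. 606)] -/
theorem exists_iso_specOver_alg :
    ∃ e : specOver R (AffineGroupScheme.Alg W) ≅ W, e.hom.left = W.left.isoSpec.inv := by
  have hw : W.left.isoSpec.inv ≫ W.hom = Spec.map (CommRingCat.ofHom (algebraMap R (AffineGroupScheme.Alg W))) := by
    rw [AffineGroupScheme.Alg.algebraMap_eq, CommRingCat.ofHom_hom, Spec.map_comp, ← Scheme.isoSpec_Spec_inv,
      Scheme.isoSpec_inv_naturality]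
  exact ⟨Over.isoMk (show (specOver R (AffineGroupScheme.Alg W)).left ≅ W.left from W.left.isoSpec.symm) hw, rfl⟩

/-- Plumbing: `Spec (A⧸I) → Spec A → Spec R` equals `Spec (A⧸I) → Spec (R⧸J) → Spec R` when `J A ⊆ I`.
[cite: MumfordFogartyKirwan1994, Ch. 7 §2 Definition 7.2 (p. 129)] -/
theorem specMap_mk_comp_specMap_algebraMap (J : Ideal R) {A : Type u} [CommRing A] [Algebra R A] (I : Ideal A)
    (hJI : J ≤ I.comap (algebraMap R A)) :
    Spec.map (CommRingCat.ofHom (Ideal.Quotient.mk I)) ≫ Spec.map (CommRingCat.ofHom (algebraMap R A)) =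
      Spec.map (CommRingCat.ofHom (Ideal.quotientMap I (algebraMap R A) hJI)) ≫
        Spec.map (CommRingCat.ofHom (Ideal.Quotient.mk J)) := by
  rw [← Spec.map_comp, ← Spec.map_comp, ← CommRingCat.ofHom_comp, ← CommRingCat.ofHom_comp, Ideal.quotientMap_comp_mk]

end Affine

end Literature.AlgebraicGeometry.GroupSchemes

end
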